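import Literature.Probability.RandomPlanarGeometry.SAWTriangularPolygonSupermult
import Mathlib.Order.PiLex
import HarnessLib

/-!
# Madras–Slade (3.2.1) on the triangular lattice: `triLoopCount N = 2N · q_N(𝕋)` — the unrooting bijection in the brick frame

Topic `Literature/Probability/RandomPlanarGeometry` (lane «pcv-sawmu», a-p4 g9; continues `SAWTriangularPolygonSupermult.lean`: the canonical
traversals `TriPolygon.triPolygonReps n` and `triPolygonNumber N = #triPolygonReps (N−1)`; `SAWTriangularPolygonPairs.lean`: `triLoopCount N`, the
rooted oriented `N`-gons of `𝕋` counted as closing `(N−1)`-step brick walks).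

Source: N. Madras, G. Slade, *The Self-Avoiding Walk* (1993), §3.2, eq. (3.2.1) p. 63: "the number of `N`-step self-avoiding polygons is
… `2N q_N` … the number of `(N−1)`-step self-avoiding walks … with `ω(N−1)` adjacent to `ω(0)`" (each class has `N` translates through the
origin and two orientations) — there for `ℤ^d`; tree `SAWPolygonUnrooting.lean` proves it for `ℤ^d` (`Zd.PolygonConcat.card_saLoops …`).  Here: the
triangular lattice in the brick frame, with `q_N(𝕋) := triPolygonNumber N` (canonical representatives), so that the lane's two normalisations of
the triangular polygon numbers — `triLoopCount N / (2N)` (`TriSAPLimitQ`) and `triPolygonNumber N` — provably agree.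

Status in print (lane lit-1 g13 cell, 2026-08-23): the identity is Whittington's "u_n = 2n p_n" [Whittington2009LatticePolygons, §2.2
eq. (2.1) p. 24] ("Each n-edge polygon can be rooted in n ways (i.e. at any vertex) and directed in two ways"; square lattice, "Almost everything
works in the same way for other lattices") = Madras–Slade (3.2.1) p. 63 (`ℤ^d` form, through walks to a fixed neighbour).  Label: CONSOLIDATION —
the kernel content is the canonical-representative bijection in the brick frame of `𝕋` and the agreement of the lane's two normalisations.

## What is proved (namespace `…SAW.TriPolygon`, headline in `…SAW`; all `theorem`s, axioms standard)

* `loops n` (closing `n`-step brick walks) with `card_loops : #loops n = triLoopCount (n+1)`;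
* cyclic re-rootings `rotF n ρ r`, `rotB n ρ r` (forward / backward traversal from the `r`-th site, translated to start at `0`),
  `rotF_mem_loops`, `rotB_mem_loops`, the composition laws `rotF_rotF`, `rotF_rotB`, `rotB_rotB`, and `rotF_zero_self`;
* `unroot_injOn` / `loops_subset_image` : `(ω, r, b) ↦ rot_b ω r` is a bijection `triPolygonReps n × [0, n] × Bool → loops n`;
* **`card_loops_eq : #loops n = 2 (n+1) · #triPolygonReps n`** (`n ≥ 2`) and
  **`triLoopCount_eq_mul_triPolygonNumber (hN : 3 ≤ N) : triLoopCount N = 2 * N * triPolygonNumber N`** ((3.2.1) on `𝕋`);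
* corollary **`triLoopCount_le_pow : (triLoopCount N : ℝ) ≤ 4N · μ(𝕋)^N`** (`N ≥ 3`);
* (3.2.3) on `𝕋`, unrooted: `tbump`/`tbump_mem`/`tbump_injOn`/`card_reps_le_succ` and **`triPolygonNumber_le_succ : q_N(𝕋) ≤ q_{N+1}(𝕋)`**.
-/

noncomputable section

open Finset Function Literature.Probability.LatticeModels Literature.Probability.Percolation SimpleGraph

namespace Literature.Probability.RandomPlanarGeometry.SAW

namespace TriPolygon

/-! ### Closing walks and cyclic re-rooting -/

section Loops

variable {n : ℕ} {ρ : ℕ → Site 2}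

open Classical in
/-- The closing `n`-step brick walks from `0` (rooted oriented `(n+1)`-gons of `𝕋` through `0`).
[cite: MadrasSlade1993, §3.2, eq. (3.2.1), p. 63] -/
def loops (n : ℕ) : Finset (ℕ → Site 2) := (brickSaws n).filter fun ρ => brickGraph.Adj (ρ n) 0

/-- Membership in `loops`. [cite: MadrasSlade1993, §3.2, eq. (3.2.1), p. 63] -/
theorem mem_loops : ρ ∈ loops n ↔ ρ ∈ brickSaws n ∧ brickGraph.Adj (ρ n) 0 := by
  classical
  exact Finset.mem_filter

/-- `#loops (N−1) = triLoopCount N`. [cite: MadrasSlade1993, §3.2, eq. (3.2.1), p. 63] -/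
theorem card_loops (n : ℕ) : #(loops n) = triLoopCount (n + 1) := by
  classical
  unfold loops triLoopCount
  simp

/-- Cyclic index `r + i (mod n+1)` for `r, i ≤ n`. [folklore] -/
def addc (n r i : ℕ) : ℕ := if r + i ≤ n then r + i else r + i - (n + 1)

/-- Cyclic index `r − i (mod n+1)` for `r, i ≤ n`. [folklore] -/
def subc (n r i : ℕ) : ℕ := if i ≤ r then r - i else r + (n + 1) - i

/-- `addc` stays in `[0, n]`. [folklore] -/
private theorem addc_le {r i : ℕ} (hr : r ≤ n) (hi : i ≤ n) : addc n r i ≤ n := by unfold addc; split_ifs <;> omega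

/-- `subc` stays in `[0, n]`. [folklore] -/
private theorem subc_le {r i : ℕ} (hr : r ≤ n) (hi : i ≤ n) : subc n r i ≤ n := by unfold subc; split_ifs <;> omega

/-- **Forward re-rooting at site `r`**: `i ↦ ρ(r + i mod n+1) − ρ r` (frozen after `n`).
[cite: MadrasSlade1993, §3.2, eq. (3.2.1) (each polygon is traversed from each of its sites)] -/
def rotF (n : ℕ) (ρ : ℕ → Site 2) (r : ℕ) : ℕ → Site 2 := fun i => ρ (addc n r (min i n)) - ρ r

/-- **Backward re-rooting at site `r`**: `i ↦ ρ(r − i mod n+1) − ρ r` (frozen after `n`).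
[cite: MadrasSlade1993, §3.2, eq. (3.2.1) (each polygon is traversed in both orientations)] -/
def rotB (n : ℕ) (ρ : ℕ → Site 2) (r : ℕ) : ℕ → Site 2 := fun i => ρ (subc n r (min i n)) - ρ r

/-- Consecutive cyclic indices are polygon bonds (including the closing bond). [cite: MadrasSlade1993, §3.2, eq. (3.2.1)] -/
theorem adj_addc (hρ : ρ ∈ loops n) {r : ℕ} (hr : r ≤ n) {i : ℕ} (hi : i < n + 1) :
    brickGraph.Adj (ρ (addc n r i)) (ρ (addc n r (i + 1))) := by
  obtain ⟨hs, hc⟩ := mem_loops.1 hρ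
  obtain ⟨h0, -, hadj, -⟩ := mem_brickSaws.1 hs
  unfold addc
  by_cases h1 : r + (i + 1) ≤ n
  · rw [if_pos (by omega), if_pos h1, show r + (i + 1) = r + i + 1 by ring]; exact hadj _ (by omega)
  · by_cases h2 : r + i ≤ n
    · rw [if_pos h2, if_neg h1, show r + i = n by omega, show r + (i + 1) - (n + 1) = 0 by omega, h0]; exact hc
    · rw [if_neg h2, if_neg h1, show r + (i + 1) - (n + 1) = r + i - (n + 1) + 1 by omega]; exact hadj _ (by omega)

/-- Consecutive backward cyclic indices are polygon bonds. [cite: MadrasSlade1993, §3.2, eq. (3.2.1)] -/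
theorem adj_subc (hρ : ρ ∈ loops n) {r : ℕ} (hr : r ≤ n) {i : ℕ} (hi : i < n + 1) :
    brickGraph.Adj (ρ (subc n r i)) (ρ (subc n r (i + 1))) := by
  obtain ⟨hs, hc⟩ := mem_loops.1 hρ
  obtain ⟨h0, -, hadj, -⟩ := mem_brickSaws.1 hs
  unfold subc
  by_cases h1 : i + 1 ≤ r
  · rw [if_pos (by omega), if_pos h1, show r - i = r - (i + 1) + 1 by omega]; exact (hadj _ (by omega)).symm
  · by_cases h2 : i ≤ r
    · rw [if_pos h2, if_neg h1, show r - i = 0 by omega, show r + (n + 1) - (i + 1) = n by omega, h0]; exact hc.symm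
    · rw [if_neg h2, if_neg h1, show r + (n + 1) - i = r + (n + 1) - (i + 1) + 1 by omega]
      exact (hadj _ (by omega)).symm

/-- `addc r` is injective on `[0,n]`. [folklore] -/
private theorem addc_inj {r i j : ℕ} (_hr : r ≤ n) (hi : i ≤ n) (hj : j ≤ n) (h : addc n r i = addc n r j) : i = j := by
  unfold addc at h; split_ifs at h <;> omega

/-- `subc r` is injective on `[0,n]`. [folklore] -/
private theorem subc_inj {r i j : ℕ} (_hr : r ≤ n) (hi : i ≤ n) (hj : j ≤ n) (h : subc n r i = subc n r j) : i = j := by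
  unfold subc at h; split_ifs at h <;> omega

/-- Injectivity of a closing walk on `[0,n]`, pointwise. [cite: MadrasSlade1993, §1.1] -/
theorem inj_of_mem_loops (hρ : ρ ∈ loops n) {i j : ℕ} (hi : i ≤ n) (hj : j ≤ n) (h : ρ i = ρ j) : i = j :=
  (mem_brickSaws.1 (mem_loops.1 hρ).1).2.2.2 hi hj h

/-- **The forward re-rooting of a closing walk is a closing walk.** [cite: MadrasSlade1993, §3.2, eq. (3.2.1)] -/
theorem rotF_mem_loops (hρ : ρ ∈ loops n) {r : ℕ} (hr : r ≤ n) : rotF n ρ r ∈ loops n := by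
  refine mem_loops.2 ⟨mem_brickSaws.2 ⟨?_, fun i hi => ?_, fun i hi => ?_, fun i hi j hj hij => ?_⟩, ?_⟩
  · simp [rotF, addc, hr]
  · simp only [rotF, min_eq_right hi, min_self]
  · simp only [rotF, min_eq_left hi.le, min_eq_left (Nat.succ_le_of_lt hi)]
    rw [brickGraph_adj_sub_right]; exact adj_addc hρ hr (by omega)
  · simp only [Set.mem_setOf_eq] at hi hj
    simp only [rotF, min_eq_left hi, min_eq_left hj] at hij
    exact addc_inj hr hi hj (inj_of_mem_loops hρ (addc_le hr hi) (addc_le hr hj) (sub_left_injective hij))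
  · simp only [rotF, min_self]
    have h := adj_addc hρ hr (show n < n + 1 by omega)
    rw [show addc n r (n + 1) = r by unfold addc; split_ifs <;> omega] at h
    have := (brickGraph_adj_sub_right (ρ (addc n r n)) (ρ r) (ρ r)).2 h
    rwa [sub_self] at this

/-- **The backward re-rooting of a closing walk is a closing walk.** [cite: MadrasSlade1993, §3.2, eq. (3.2.1)] -/
theorem rotB_mem_loops (hρ : ρ ∈ loops n) {r : ℕ} (hr : r ≤ n) : rotB n ρ r ∈ loops n := by
  refine mem_loops.2 ⟨mem_brickSaws.2 ⟨?_, fun i hi => ?_, fun i hi => ?_, fun i hi j hj hij => ?_⟩, ?_⟩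
  · simp [rotB, subc]
  · simp only [rotB, min_eq_right hi, min_self]
  · simp only [rotB, min_eq_left hi.le, min_eq_left (Nat.succ_le_of_lt hi)]
    rw [brickGraph_adj_sub_right]; exact adj_subc hρ hr (by omega)
  · simp only [Set.mem_setOf_eq] at hi hj
    simp only [rotB, min_eq_left hi, min_eq_left hj] at hij
    exact subc_inj hr hi hj (inj_of_mem_loops hρ (subc_le hr hi) (subc_le hr hj) (sub_left_injective hij))
  · simp only [rotB, min_self]
    have h := adj_subc hρ hr (show n < n + 1 by omega)
    rw [show subc n r (n + 1) = r by unfold subc; split_ifs <;> omega] at h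
    have := (brickGraph_adj_sub_right (ρ (subc n r n)) (ρ r) (ρ r)).2 h
    rwa [sub_self] at this

/-- Values of the re-rootings at times `≤ n`. [folklore] -/
private theorem rotF_apply {r i : ℕ} (hi : i ≤ n) : rotF n ρ r i = ρ (addc n r i) - ρ r := by simp [rotF, min_eq_left hi]
/-- Values of the re-rootings at times `≤ n`. [folklore] -/
private theorem rotB_apply {r i : ℕ} (hi : i ≤ n) : rotB n ρ r i = ρ (subc n r i) - ρ r := by simp [rotB, min_eq_left hi]

/-- `rotF ρ 0 = ρ` for a walk frozen after `n` and starting at `0`. [folklore] -/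
private theorem rotF_zero_self (hρ : ρ ∈ brickSaws n) : rotF n ρ 0 = ρ := by
  obtain ⟨h0, hfr, -, -⟩ := mem_brickSaws.1 hρ
  funext i
  simp only [rotF, h0, sub_zero, addc, zero_add]
  rcases le_or_gt i n with hi | hi
  · rw [min_eq_left hi, if_pos hi]
  · rw [min_eq_right hi.le, if_pos le_rfl, hfr i hi.le]

/-- Composition law `rotF (rotF ρ r) s = rotF ρ (r ⊕ s)`. [folklore] -/
private theorem rotF_rotF {r s : ℕ} (hr : r ≤ n) (hs : s ≤ n) : rotF n (rotF n ρ r) s = rotF n ρ (addc n r s) := by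
  funext i
  have hm : min i n ≤ n := min_le_right _ _
  simp only [rotF, min_eq_left hs, min_eq_left (addc_le hs hm)]
  rw [show ρ (addc n r (addc n s (min i n))) - ρ r - (ρ (addc n r s) - ρ r) =
    ρ (addc n r (addc n s (min i n))) - ρ (addc n r s) by abel]
  congr 2
  unfold addc; split_ifs <;> omega

/-- Composition law `rotF (rotB ρ r) s = rotB ρ (r ⊖ s)`. [folklore] -/
private theorem rotF_rotB {r s : ℕ} (hr : r ≤ n) (hs : s ≤ n) : rotF n (rotB n ρ r) s = rotB n ρ (subc n r s) := by
  funext i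
  have hm : min i n ≤ n := min_le_right _ _
  simp only [rotF, rotB, min_eq_left hs, min_eq_left (addc_le hs hm)]
  rw [show ρ (subc n r (addc n s (min i n))) - ρ r - (ρ (subc n r s) - ρ r) =
    ρ (subc n r (addc n s (min i n))) - ρ (subc n r s) by abel]
  congr 2
  unfold addc subc; split_ifs <;> omega

/-- Composition law `rotB (rotB ρ r) s = rotF ρ (r ⊖ s)`. [folklore] -/
private theorem rotB_rotB {r s : ℕ} (hr : r ≤ n) (hs : s ≤ n) : rotB n (rotB n ρ r) s = rotF n ρ (subc n r s) := by
  funext i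
  have hm : min i n ≤ n := min_le_right _ _
  simp only [rotF, rotB, min_eq_left hs, min_eq_left (subc_le hs hm)]
  rw [show ρ (subc n r (subc n s (min i n))) - ρ r - (ρ (subc n r s) - ρ r) =
    ρ (subc n r (subc n s (min i n))) - ρ (subc n r s) by abel]
  congr 2
  unfold addc subc; split_ifs <;> omega

end Loops

/-! ### The lexicographically smallest site -/

section LexMin

variable {n : ℕ} {ρ : ℕ → Site 2}

/-- `toLex x ≤ toLex y` on `ℤ²` in coordinates. [folklore] -/
private theorem toLex_le_iff_coord {x y : Site 2} : toLex x ≤ toLex y ↔ x 0 < y 0 ∨ (x 0 = y 0 ∧ x 1 ≤ y 1) := by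
  constructor
  · intro h
    rcases h.lt_or_eq with h | h
    · obtain ⟨i, hi, hlt⟩ := h
      fin_cases i
      · exact Or.inl hlt
      · exact Or.inr ⟨hi 0 (by decide), hlt.le⟩
    · rw [EmbeddingLike.apply_eq_iff_eq] at h
      subst h; exact Or.inr ⟨rfl, le_rfl⟩
  · rintro (h | ⟨h0, h1⟩)
    · exact le_of_lt ⟨0, fun j hj => absurd hj (by simp), h⟩
    · rcases h1.lt_or_eq with h1 | h1
      · refine le_of_lt ⟨1, fun j hj => ?_, h1⟩
        have : j = 0 := by
          rcases Fin.eq_zero_or_eq_succ j with rfl | ⟨k, rfl⟩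
          · rfl
          · exfalso; fin_cases k; simp at hj
        subst this; exact h0
      · have : x = y := by
          funext i; fin_cases i
          · exact h0
          · exact h1
        rw [this]

/-- `LexNonneg (y − x) ↔ toLex x ≤ toLex y` (translation invariance). [folklore] -/
private theorem lexNonneg_sub_iff {x y : Site 2} : LexNonneg (y - x) ↔ toLex x ≤ toLex y := by
  rw [toLex_le_iff_coord]; unfold LexNonneg; simp only [Pi.sub_apply]; omega

/-- `LexLT x y ↔ toLex x < toLex y`. [folklore] -/
private theorem lexLT_iff {x y : Site 2} : LexLT x y ↔ toLex x < toLex y := by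
  rw [lt_iff_le_not_ge, toLex_le_iff_coord, toLex_le_iff_coord]; unfold LexLT; omega

/-- A closing walk has a site of lexicographically smallest value among times `≤ n`. [cite: MadrasSlade1993, §3.2 (proof of Theorem 3.2.3: "lexicographically smallest point")] -/
theorem exists_lexMin (n : ℕ) (ρ : ℕ → Site 2) : ∃ i₀, i₀ ≤ n ∧ ∀ j, j ≤ n → toLex (ρ i₀) ≤ toLex (ρ j) := by
  classical
  obtain ⟨i₀, hi₀, h⟩ := exists_min_image (range (n + 1)) (fun i => toLex (ρ i)) ⟨0, by simp⟩
  simp only [mem_range, Nat.lt_succ_iff] at hi₀ h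
  exact ⟨i₀, hi₀, h⟩

/-- All sites of `rotF ρ i₀` / `rotB ρ i₀` are lexicographically `≥ 0` when `i₀` is a lexicographic minimum of `ρ`.
[cite: MadrasSlade1993, §3.2 (proof of Theorem 3.2.3: `Q[N]`)] -/
theorem lexNonneg_rot_of_min {i₀ : ℕ} (hi₀ : i₀ ≤ n) (hmin : ∀ j, j ≤ n → toLex (ρ i₀) ≤ toLex (ρ j)) :
    (∀ i, i ≤ n → LexNonneg (rotF n ρ i₀ i)) ∧ ∀ i, i ≤ n → LexNonneg (rotB n ρ i₀ i) := by
  refine ⟨fun i hi => ?_, fun i hi => ?_⟩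
  · rw [rotF_apply hi, lexNonneg_sub_iff]; exact hmin _ (addc_le hi₀ hi)
  · rw [rotB_apply hi, lexNonneg_sub_iff]; exact hmin _ (subc_le hi₀ hi)

/-- Conversely, a canonical walk (all sites `≽ 0`, `ω 0 = 0`) attains its lexicographic minimum ONLY at the sites equal to `0`, i.e. at
time `0` on `[0,n]`. [cite: MadrasSlade1993, §3.2 (proof of Theorem 3.2.3: "exactly `q_N` members")] -/
theorem eq_zero_of_lexMin (hω : ρ ∈ brickSaws n) (hl : ∀ i, i ≤ n → LexNonneg (ρ i)) {i₀ : ℕ} (hi₀ : i₀ ≤ n)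
    (hmin : ∀ j, j ≤ n → toLex (ρ i₀) ≤ toLex (ρ j)) : i₀ = 0 := by
  obtain ⟨h0, -, -, hinj⟩ := mem_brickSaws.1 hω
  have h1 := hmin 0 (Nat.zero_le _)
  have h2 : toLex (ρ 0) ≤ toLex (ρ i₀) := by
    have := hl i₀ hi₀; rw [h0]; rw [← sub_zero (ρ i₀)] at this; exact lexNonneg_sub_iff.1 this
  have heq : ρ i₀ = ρ 0 := toLex_inj.1 (le_antisymm h1 h2)
  exact hinj (show i₀ ∈ {i | i ≤ n} by simpa using hi₀) (show 0 ∈ {i | i ≤ n} by simp) heq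

end LexMin

/-! ### The unrooting bijection -/

section Unroot

variable {n : ℕ}

/-- The re-rooting map `(ω, r, b) ↦ rot_b ω r`. [cite: MadrasSlade1993, §3.2, eq. (3.2.1)] -/
def unroot (n : ℕ) (x : (ℕ → Site 2) × ℕ × Bool) : ℕ → Site 2 :=
  if x.2.2 then rotB n x.1 x.2.1 else rotF n x.1 x.2.1

/-- The time at which `rot_b ω r` passes through (the translate of) `ω 0`. [folklore] -/
def idx0 (n r : ℕ) (b : Bool) : ℕ := if b then r else subc n 0 r

/-- `idx0 ≤ n`. [folklore] -/
private theorem idx0_le {r : ℕ} (hr : r ≤ n) (b : Bool) : idx0 n r b ≤ n := by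
  unfold idx0 subc; split_ifs <;> omega

/-- At time `idx0` the re-rooted walk sits at `−ω r`, and this is its lexicographic minimum when `ω` is canonical.
[cite: MadrasSlade1993, §3.2 (proof of Theorem 3.2.3)] -/
theorem unroot_idx0 {ω : ℕ → Site 2} (hω : ω ∈ triPolygonReps n) {r : ℕ} (hr : r ≤ n) (b : Bool) :
    unroot n (ω, r, b) (idx0 n r b) = -ω r ∧
      ∀ j, j ≤ n → toLex (unroot n (ω, r, b) (idx0 n r b)) ≤ toLex (unroot n (ω, r, b) j) := by
  obtain ⟨hs, -, hl, -⟩ := mem_triPolygonReps.1 hω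
  obtain ⟨h0, -, -, -⟩ := mem_brickSaws.1 hs
  have hval : unroot n (ω, r, b) (idx0 n r b) = -ω r := by
    unfold unroot idx0
    cases b
    · simp only [Bool.false_eq_true, if_false]
      rw [rotF_apply (subc_le (Nat.zero_le _) hr)]
      rw [show addc n r (subc n 0 r) = 0 by unfold addc subc; split_ifs <;> omega, h0]; abel
    · simp only [if_true]
      rw [rotB_apply hr, show subc n r r = 0 by unfold subc; rw [if_pos le_rfl]; omega, h0]; abel
  refine ⟨hval, fun j hj => ?_⟩
  rw [hval]
  unfold unroot
  cases b
  · simp only [Bool.false_eq_true, if_false]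
    rw [rotF_apply hj, ← lexNonneg_sub_iff, show ω (addc n r j) - ω r - -ω r = ω (addc n r j) by abel]
    exact hl _ (addc_le hr hj)
  · simp only [if_true]
    rw [rotB_apply hj, ← lexNonneg_sub_iff, show ω (subc n r j) - ω r - -ω r = ω (subc n r j) by abel]
    exact hl _ (subc_le hr hj)

/-- Re-rooting the re-rooted walk at `idx0` forward recovers `ω` (forward case) or its reversal `rotB ω 0` (backward case).
[cite: MadrasSlade1993, §3.2, eq. (3.2.1)] -/
theorem rotF_unroot_idx0 {ω : ℕ → Site 2} (hω : ω ∈ brickSaws n) {r : ℕ} (hr : r ≤ n) (b : Bool) :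
    rotF n (unroot n (ω, r, b)) (idx0 n r b) = if b then rotB n ω 0 else ω := by
  unfold unroot idx0
  cases b
  · simp only [Bool.false_eq_true, if_false]
    rw [rotF_rotF hr (subc_le (Nat.zero_le _) hr), show addc n r (subc n 0 r) = 0 by unfold addc subc; split_ifs <;> omega,
      rotF_zero_self hω]
  · simp only [if_true]
    rw [rotF_rotB hr hr, show subc n r r = 0 by unfold subc; rw [if_pos le_rfl]; omega]

/-- The reversal `rotB ω 0` of a canonical traversal is NOT canonical: its first and last sites are swapped.
[cite: MadrasSlade1993, §3.2 (proof of Theorem 3.2.3: the two orientations)] -/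
theorem rotB_zero_one_last {ω : ℕ → Site 2} (hω : ω ∈ brickSaws n) (hn : 1 ≤ n) :
    rotB n ω 0 1 = ω n ∧ rotB n ω 0 n = ω 1 := by
  obtain ⟨h0, -, -, -⟩ := mem_brickSaws.1 hω
  rw [rotB_apply hn, rotB_apply le_rfl, h0, sub_zero, sub_zero]
  refine ⟨?_, ?_⟩ <;> congr 1 <;> unfold subc <;> split_ifs <;> omega

/-- `LexLT` is asymmetric. [folklore] -/
private theorem lexLT_asymm {x y : Site 2} (h : LexLT x y) : ¬ LexLT y x := by
  unfold LexLT at *; omega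

open Classical in
/-- **The unrooting map is injective on `Q[n+1] × [0,n] × Bool`** (`n ≥ 2`): the lexicographic minimum of the image locates the root,
the orientation test `ω 1 ≺ ω n` the direction. [cite: MadrasSlade1993, §3.2, eq. (3.2.1) ("`2N q_N` is the number of …")] -/
theorem unroot_injOn (hn : 2 ≤ n) :
    Set.InjOn (unroot n) ↑(triPolygonReps n ×ˢ (range (n + 1) ×ˢ (univ : Finset Bool))) := by
  rintro ⟨ω, r, b⟩ hx ⟨ω', r', b'⟩ hx' hW
  simp only [Finset.coe_product, Set.mem_prod, Finset.mem_coe, Finset.mem_range, Nat.lt_succ_iff, Finset.coe_univ,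
    Set.mem_univ, and_true] at hx hx'
  obtain ⟨hω, hr⟩ := hx
  obtain ⟨hω', hr'⟩ := hx'
  have hs := (mem_triPolygonReps.1 hω).1
  have hs' := (mem_triPolygonReps.1 hω').1
  -- the two lexicographic minima coincide
  obtain ⟨hv, hmin⟩ := unroot_idx0 hω hr b
  obtain ⟨hv', hmin'⟩ := unroot_idx0 hω' hr' b'
  have hWl : unroot n (ω, r, b) ∈ loops n := by
    unfold unroot; cases b
    · exact rotF_mem_loops (mem_loops.2 ⟨hs, (mem_triPolygonReps.1 hω).2.1⟩) hr
    · exact rotB_mem_loops (mem_loops.2 ⟨hs, (mem_triPolygonReps.1 hω).2.1⟩) hr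
  have hidx : idx0 n r b = idx0 n r' b' := by
    have h1 := hmin (idx0 n r' b') (idx0_le hr' b')
    have h2 := hmin' (idx0 n r b) (idx0_le hr b)
    rw [← hW] at h2
    have heq := toLex_inj.1 (le_antisymm h1 h2)
    exact inj_of_mem_loops hWl (idx0_le hr b) (idx0_le hr' b') heq
  -- re-root both at that time
  have hU := rotF_unroot_idx0 hs hr b
  have hU' := rotF_unroot_idx0 hs' hr' b'
  rw [hW, hidx, hU'] at hU
  -- hU : (if b' then rotB ω' 0 else ω') = (if b then rotB ω 0 else ω)
  obtain ⟨-, -, -, hlt⟩ := mem_triPolygonReps.1 hω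
  obtain ⟨-, -, -, hlt'⟩ := mem_triPolygonReps.1 hω'
  have hrev := rotB_zero_one_last hs (by omega)
  have hrev' := rotB_zero_one_last hs' (by omega)
  cases b <;> cases b' <;> simp only [Bool.false_eq_true, if_false, if_true] at hU hidx
  · -- fwd / fwd
    subst hU
    have : r = r' := by unfold idx0 subc at hidx; simp only [Bool.false_eq_true, if_false] at hidx; split_ifs at hidx <;> omega
    subst this; rfl
  · -- b = false, b' = true: ω = rotB ω' 0, orientation clash
    exfalso
    have h1 : ω 1 = ω' n := by rw [← hU]; exact hrev'.1
    have h2 : ω n = ω' 1 := by rw [← hU]; exact hrev'.2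
    rw [h1, h2] at hlt
    exact lexLT_asymm hlt hlt'
  · exfalso
    have h1 : ω' 1 = ω n := by rw [hU]; exact hrev.1
    have h2 : ω' n = ω 1 := by rw [hU]; exact hrev.2
    rw [h1, h2] at hlt'
    exact lexLT_asymm hlt hlt'
  · -- bwd / bwd
    have hωω : ω = ω' := by
      have : rotB n (rotB n ω' 0) 0 = rotB n (rotB n ω 0) 0 := by rw [hU]
      rw [rotB_rotB (n := n) (Nat.zero_le n) (Nat.zero_le n), rotB_rotB (n := n) (Nat.zero_le n) (Nat.zero_le n),
        show subc n 0 0 = 0 by unfold subc; simp, rotF_zero_self hs', rotF_zero_self hs] at this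
      exact this.symm
    subst hωω
    have : r = r' := by unfold idx0 at hidx; simpa using hidx
    subst this; rfl

open Classical in
/-- **Every closing walk is a re-rooting of a canonical traversal** (`n ≥ 2`): re-root at the lexicographically smallest site, in the
orientation that makes `ω 1 ≺ ω n`. [cite: MadrasSlade1993, §3.2, eq. (3.2.1)] -/
theorem loops_subset_image (hn : 2 ≤ n) :
    loops n ⊆ (triPolygonReps n ×ˢ (range (n + 1) ×ˢ (univ : Finset Bool))).image (unroot n) := by
  intro W hW
  obtain ⟨hs, hc⟩ := mem_loops.1 hW
  obtain ⟨i₀, hi₀, hmin⟩ := exists_lexMin n W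
  obtain ⟨hlF, hlB⟩ := lexNonneg_rot_of_min hi₀ hmin
  have hF := rotF_mem_loops hW hi₀
  have hB := rotB_mem_loops hW hi₀
  rw [Finset.mem_image]
  -- orientation test on the forward re-rooting
  have hne : rotF n W i₀ 1 ≠ rotF n W i₀ n := fun h => by
    have := inj_of_mem_loops hF (by omega) le_rfl h; omega
  have hswap : rotB n W i₀ 1 = rotF n W i₀ n ∧ rotB n W i₀ n = rotF n W i₀ 1 := by
    rw [rotB_apply (by omega), rotB_apply le_rfl, rotF_apply le_rfl, rotF_apply (by omega)]
    refine ⟨?_, ?_⟩ <;> congr 2 <;> unfold addc subc <;> split_ifs <;> omega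
  by_cases hlt : LexLT (rotF n W i₀ 1) (rotF n W i₀ n)
  · refine ⟨(rotF n W i₀, subc n 0 i₀, false), ?_, ?_⟩
    · simp only [Finset.mem_product, Finset.mem_range, Nat.lt_succ_iff, Finset.mem_univ, and_true]
      exact ⟨mem_triPolygonReps.2 ⟨(mem_loops.1 hF).1, (mem_loops.1 hF).2, hlF, hlt⟩, subc_le (Nat.zero_le _) hi₀⟩
    · unfold unroot
      simp only [Bool.false_eq_true, if_false]
      rw [rotF_rotF hi₀ (subc_le (Nat.zero_le _) hi₀),
        show addc n i₀ (subc n 0 i₀) = 0 by unfold addc subc; split_ifs <;> omega, rotF_zero_self hs]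
  · have hlt' : LexLT (rotB n W i₀ 1) (rotB n W i₀ n) := by
      rw [hswap.1, hswap.2]
      rw [lexLT_iff] at hlt ⊢
      rcases lt_trichotomy (toLex (rotF n W i₀ 1)) (toLex (rotF n W i₀ n)) with h | h | h
      · exact absurd h hlt
      · exact absurd (toLex_inj.1 h) hne
      · exact h
    refine ⟨(rotB n W i₀, i₀, true), ?_, ?_⟩
    · simp only [Finset.mem_product, Finset.mem_range, Nat.lt_succ_iff, Finset.mem_univ, and_true]
      exact ⟨mem_triPolygonReps.2 ⟨(mem_loops.1 hB).1, (mem_loops.1 hB).2, hlB, hlt'⟩, hi₀⟩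
    · unfold unroot
      simp only [if_true]
      rw [rotB_rotB hi₀ hi₀, show subc n i₀ i₀ = 0 by unfold subc; rw [if_pos le_rfl]; omega, rotF_zero_self hs]

open Classical in
/-- **`#loops n = 2(n+1) · #Q[n+1]`** (`n ≥ 2`): "u_n = 2n p_n".
[cite: Whittington2009LatticePolygons, §2.2 eq. (2.1) p. 24 ("u_n = 2n p_n"; square lattice, "works in the same way for other lattices")]
[cite: MadrasSlade1993, §3.2, eq. (3.2.1), p. 63 (ℤ^d form)] -/
theorem card_loops_eq (hn : 2 ≤ n) : #(loops n) = 2 * (n + 1) * #(triPolygonReps n) := by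
  classical
  have hmaps : Set.MapsTo (unroot n) ↑(triPolygonReps n ×ˢ (range (n + 1) ×ˢ (univ : Finset Bool))) ↑(loops n) := by
    rintro ⟨ω, r, b⟩ hx
    simp only [Finset.coe_product, Set.mem_prod, Finset.mem_coe, Finset.mem_range, Nat.lt_succ_iff, Finset.coe_univ,
      Set.mem_univ, and_true] at hx
    obtain ⟨hω, hr⟩ := hx
    have hl : ω ∈ loops n := mem_loops.2 ⟨(mem_triPolygonReps.1 hω).1, (mem_triPolygonReps.1 hω).2.1⟩
    show unroot n (ω, r, b) ∈ loops n
    unfold unroot; cases b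
    · exact rotF_mem_loops hl hr
    · exact rotB_mem_loops hl hr
  have h1 := Finset.card_le_card_of_injOn _ hmaps (unroot_injOn hn)
  have h2 := (Finset.card_le_card (loops_subset_image hn)).trans Finset.card_image_le
  rw [Finset.card_product, Finset.card_product, Finset.card_range, Finset.card_univ, Fintype.card_bool] at h1 h2
  have : #(triPolygonReps n) * ((n + 1) * 2) = 2 * (n + 1) * #(triPolygonReps n) := by ring
  omega

end Unroot

/-! ### (3.2.3) on `𝕋`, unrooted: `q_N(𝕋) ≤ q_{N+1}(𝕋)` (one triangle bumped out of the column of maximal `X`) -/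

section Bump

variable {n : ℕ} {ω ω' : ℕ → Site 2} {j : ℕ}

/-- coordinate of `A`. [folklore] -/
private theorem sA_apply_zero : sA 0 = 2 := rfl
/-- coordinate of `A`. [folklore] -/
private theorem sA_apply_one : sA 1 = 0 := rfl

/-- The bumped walk: the fresh site `lo + A` (= `p + d + A`, adjacent to both endpoints of the cut) inserted between `ω j` and `ω (j+1)`;
it is `tglue 0 ω j D` with the one-site detour `D 0 = loSite ω j + A`.
[cite: MadrasSlade1993, Theorem 3.2.3, eq. (3.2.3) p. 64 (proof: "add the three bonds of the walk `(p, p + e(1), p + e(1) − e(I), p − e(I))`"; on 𝕋 one triangle suffices)] -/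
def tbump (ω : ℕ → Site 2) (j : ℕ) : ℕ → Site 2 := tglue 0 ω j (fun _ => loSite ω j + sA)

/-- **The bumped walk is a canonical traversal of length `n + 1`** (for `ω ∈ Q[n+1]` cut at `j = cutOf`).
[cite: MadrasSlade1993, Theorem 3.2.3, eq. (3.2.3) p. 64] -/
theorem tbump_mem (hω : ω ∈ triPolygonReps n) (h : IsCut n ω j) (hj1 : 1 ≤ j) : tbump ω j ∈ triPolygonReps (n + 1) := by
  obtain ⟨hs, hc, hl, hlt⟩ := mem_triPolygonReps.1 hω
  obtain ⟨h0, hfr, hadj, hinj⟩ := mem_brickSaws.1 hs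
  have hX := (le_topX h).1
  have hjn := h.1
  set v : Site 2 := loSite ω j + sA with hv
  -- the fresh site: column `topX + 1`, adjacent to both endpoints of the cut
  have hvX : v 0 = topX ω j + 1 := by
    have hcut := h.2
    rw [hv]
    unfold loSite IsFwd topX
    split_ifs with hf <;> simp only [Pi.add_apply, sA_apply_zero] <;> omega
  have hadjv : brickGraph.Adj (ω j) v ∧ brickGraph.Adj v (ω (j + 1)) := by
    have ha := hadj j hjn
    rw [brickGraph_adj_iff] at ha
    rcases h.2 with ⟨h1, -⟩ | ⟨h1, -⟩
    · -- backward cut: `lo = ω (j+1)`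
      have hnf : ¬ IsFwd ω j := by unfold IsFwd; omega
      have hv' : v = ω (j + 1) + sA := by rw [hv]; unfold loSite; rw [if_neg hnf]
      rw [hv']
      refine ⟨?_, (adj_add_sA _).symm⟩
      rw [brickGraph_adj_iff]; simp only [Pi.add_apply, sA_apply_zero, sA_apply_one]; omega
    · have hf : IsFwd ω j := h1
      have hv' : v = ω j + sA := by rw [hv]; unfold loSite; rw [if_pos hf]
      rw [hv']
      refine ⟨adj_add_sA _, ?_⟩
      rw [brickGraph_adj_iff]; simp only [Pi.add_apply, sA_apply_zero, sA_apply_one]; unfold IsFwd at hf; omega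
  have hW : ∀ i, tbump ω j i = tglue 0 ω j (fun _ => v) i := fun i => rfl
  refine mem_triPolygonReps.2 ⟨mem_brickSaws.2 ⟨?_, fun i hi => ?_, fun i hi => ?_, ?_⟩, ?_, fun i hi => ?_, ?_⟩
  · rw [hW, tglue_of_le (Nat.zero_le _), h0]
  · rw [hW, hW, tglue_of_ge (by omega), tglue_of_ge (by omega), hfr (i - (0 + 1)) (by omega),
      show n + 1 - (0 + 1) = n by omega]
  · rw [hW, hW]
    rcases Nat.lt_or_ge i j with h1 | h1
    · rw [tglue_of_le h1.le, tglue_of_le (by omega)]; exact hadj i (by omega)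
    rcases eq_or_lt_of_le h1 with h2 | h2
    · rw [← h2, tglue_of_le le_rfl, show j + 1 = j + 1 + 0 by rfl, tglue_detour le_rfl]; exact hadjv.1
    rcases eq_or_lt_of_le (Nat.succ_le_of_lt h2) with h3 | h3
    · rw [← h3, show j.succ = j + 1 + 0 by rfl, tglue_detour le_rfl, tglue_of_ge (by omega),
        show j + 1 + 0 + 1 - (0 + 1) = j + 1 by omega]; exact hadjv.2
    · rw [tglue_of_ge (by omega), tglue_of_ge (by omega), show i + 1 - (0 + 1) = i - (0 + 1) + 1 by omega]
      exact hadj _ (by omega)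
  · -- injectivity on `[0, n+1]`: `v` is the only site in column `topX + 1`
    intro a ha b hb hab
    simp only [Set.mem_setOf_eq] at ha hb
    rw [hW, hW] at hab
    have key : ∀ c, c ≤ n + 1 → (c ≤ j ∧ tglue 0 ω j (fun _ => v) c = ω c) ∨ (c = j + 1 ∧ tglue 0 ω j (fun _ => v) c = v) ∨
        (j + 2 ≤ c ∧ tglue 0 ω j (fun _ => v) c = ω (c - 1)) := by
      intro c hc
      rcases le_or_gt c j with h1 | h1
      · exact Or.inl ⟨h1, tglue_of_le h1⟩
      rcases le_or_gt c (j + 1) with h2 | h2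
      · exact Or.inr (Or.inl ⟨by omega, by rw [show c = j + 1 + 0 by omega, tglue_detour le_rfl]⟩)
      · exact Or.inr (Or.inr ⟨by omega, by rw [tglue_of_ge (by omega)]⟩)
    have hωv : ∀ c, ω c ≠ v := fun c heq => by
      have h1 : ω c 0 ≤ topX ω j := by
        rcases le_or_gt c n with hc | hc
        · exact hX c hc
        · rw [hfr c hc.le]; exact hX n le_rfl
      rw [heq, hvX] at h1; omega
    rcases key a ha with ⟨ha1, ha2⟩ | ⟨rfl, ha2⟩ | ⟨ha1, ha2⟩ <;>
      rcases key b hb with ⟨hb1, hb2⟩ | ⟨rfl, hb2⟩ | ⟨hb1, hb2⟩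
    · rw [ha2, hb2] at hab; exact hinj (show a ∈ {i | i ≤ n} by simp; omega) (show b ∈ {i | i ≤ n} by simp; omega) hab
    · rw [ha2, hb2] at hab; exact absurd hab (hωv a)
    · rw [ha2, hb2] at hab
      have := hinj (show a ∈ {i | i ≤ n} by simp; omega) (show b - 1 ∈ {i | i ≤ n} by simp; omega) hab; omega
    · rw [ha2, hb2] at hab; exact absurd hab.symm (hωv b)
    · rfl
    · rw [ha2, hb2] at hab; exact absurd hab.symm (hωv _)
    · rw [ha2, hb2] at hab
      have := hinj (show a - 1 ∈ {i | i ≤ n} by simp; omega) (show b ∈ {i | i ≤ n} by simp; omega) hab; omega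
    · rw [ha2, hb2] at hab; exact absurd hab (hωv _)
    · rw [ha2, hb2] at hab
      have := hinj (show a - 1 ∈ {i | i ≤ n} by simp; omega) (show b - 1 ∈ {i | i ≤ n} by simp; omega) hab; omega
  · rw [hW, tglue_of_ge (by omega), show n + 1 - (0 + 1) = n by omega]; exact hc
  · rw [hW]
    rcases le_or_gt i j with h1 | h1
    · rw [tglue_of_le h1]; exact hl i (by omega)
    rcases le_or_gt i (j + 1) with h2 | h2
    · rw [show i = j + 1 + 0 by omega, tglue_detour le_rfl]; left
      have := hX 0 (Nat.zero_le _); rw [h0] at this; simp only [Pi.zero_apply] at this; omega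
    · rw [tglue_of_ge (by omega)]; exact hl _ (by omega)
  · rw [hW, hW, tglue_of_le hj1, tglue_of_ge (by omega), show n + 1 - (0 + 1) = n by omega]; exact hlt

/-- **The bump is injective on `Q[n+1]`**: the cut time is read off the bumped walk (the inserted site is the unique one in column `topX + 1`).
[cite: MadrasSlade1993, Theorem 3.2.3, eq. (3.2.3) p. 64] -/
theorem tbump_injOn : Set.InjOn (fun ω : ℕ → Site 2 => tbump ω (cutOf n ω)) ↑(triPolygonReps n) := by
  intro ω hω ω' hω' hW
  rw [Finset.mem_coe] at hω hω'
  have hn := two_le_of_mem_reps hω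
  have hh := halfLoops_of_reps hω
  have hh' := halfLoops_of_reps hω'
  have hcut := cutOf_spec hh hn
  have hcut' := cutOf_spec hh' hn
  have hW' : ∀ i, i ≤ n + 0 + 1 → tglue 0 ω (cutOf n ω) (fun _ => loSite ω (cutOf n ω) + sA) i =
      tglue 0 ω' (cutOf n ω') (fun _ => loSite ω' (cutOf n ω') + sA) i := fun i _ => congrFun hW i
  have hcol : ∀ (υ : ℕ → Site 2) (k : ℕ), IsCut n υ k → ∀ i, i ≤ 0 → topX υ k + 1 ≤ (loSite υ k + sA) 0 := by
    intro υ k hk i _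
    have hk2 := hk.2
    unfold loSite IsFwd topX
    split_ifs with hf <;> simp only [Pi.add_apply, sA_apply_zero] <;> omega
  have hjj : cutOf n ω = cutOf n ω' :=
    tcut_eq hcut.1 hcut'.1 (le_topX hcut).1 (hcol ω _ hcut) (le_topX hcut').1 (hcol ω' _ hcut') hW'
  rw [← hjj] at hW'
  exact tleft_eq (m := 0) (mem_triPolygonReps.1 hω).1 (mem_triPolygonReps.1 hω').1 hW'

/-- **Canonical form of (3.2.3) on `𝕋`: `#Q[n+1] ≤ #Q[n+2]`.** [cite: MadrasSlade1993, Theorem 3.2.3, eq. (3.2.3) p. 64] -/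
theorem card_reps_le_succ (n : ℕ) : #(triPolygonReps n) ≤ #(triPolygonReps (n + 1)) := by
  classical
  refine Finset.card_le_card_of_injOn (fun ω => tbump ω (cutOf n ω)) (fun ω hω => ?_) tbump_injOn
  rw [Finset.mem_coe] at hω ⊢
  have hn := two_le_of_mem_reps hω
  have hcut := cutOf_spec (halfLoops_of_reps hω) hn
  exact tbump_mem hω hcut (one_le_cut (halfLoops_of_reps hω) hn hcut)

end Bump

end TriPolygon

/-! ### (3.2.1) on `𝕋` and the rooted corollary -/

open TriPolygon in
/-- **Madras–Slade (3.2.1) on the triangular lattice: `triLoopCount N = 2N · q_N(𝕋)`** (`N ≥ 3`) — the lane's two normalisations of the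
triangular polygon numbers agree: `triLoopCount N / (2N) = triPolygonNumber N`.
[cite: Whittington2009LatticePolygons, §2.2 eq. (2.1) p. 24 ("u_n = 2n p_n"; square lattice, "works in the same way for other lattices")]
[cite: MadrasSlade1993, §3.2, eq. (3.2.1), p. 63 (ℤ^d form)] -/
theorem triLoopCount_eq_mul_triPolygonNumber {N : ℕ} (hN : 3 ≤ N) : triLoopCount N = 2 * N * triPolygonNumber N := by
  obtain ⟨n, rfl⟩ : ∃ n, N = n + 1 := ⟨N - 1, by omega⟩
  rw [← card_loops, card_loops_eq (by omega)]
  unfold triPolygonNumber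
  simp

open TriPolygon in
/-- **`triLoopCount N ≤ 4N · μ(𝕋)^N`** (`N ≥ 3`): the rooted oriented triangular polygon count with a LINEAR prefactor (from
`q_N(𝕋) ≤ 2 μ(𝕋)^N` and (3.2.1)), in place of the tree's `e^{(53 + 3 log μ)√N}` envelope `abs_log_triLoopCount_sub_le`.
[cite: MadrasSlade1993, §3.2, eqs. (3.2.1) p. 63 and (3.2.5) p. 65] -/
theorem triLoopCount_le_pow {N : ℕ} (hN : 3 ≤ N) : (triLoopCount N : ℝ) ≤ 4 * N * Real.exp logMuTri ^ N := by
  rw [triLoopCount_eq_mul_triPolygonNumber hN]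
  have h := triPolygonNumber_le_pow hN
  have hN0 : (0 : ℝ) ≤ N := Nat.cast_nonneg _
  push_cast
  nlinarith [h, hN0, pow_nonneg (Real.exp_pos logMuTri).le N]

open TriPolygon in
/-- **Madras–Slade (3.2.3) on the triangular lattice, unrooted and with the natural shift `+1`: `q_N(𝕋) ≤ q_{N+1}(𝕋)`** for every `N`
(the tree's rooted `triLoopCount_le_succ` gives only `2N q_N ≤ 2(N+1) q_{N+1}`). [cite: MadrasSlade1993, Theorem 3.2.3, eq. (3.2.3) p. 64 (ℤ^d, shift 2; triangular edition proved here)] -/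
theorem triPolygonNumber_le_succ (N : ℕ) : triPolygonNumber N ≤ triPolygonNumber (N + 1) := by
  unfold triPolygonNumber
  rcases Nat.eq_zero_or_pos N with rfl | hN
  · simp
  · rw [show N + 1 - 1 = N - 1 + 1 by omega]; exact card_reps_le_succ _

end Literature.Probability.RandomPlanarGeometry.SAW

end
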